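import Summits.FinalStateConjecture.FinalStateConjecture.Theorems.ClusterCompletenessOmegaLimitMultiKerrDefs
import Summits.FinalStateConjecture.FinalStateConjecture.Theorems.UniversalWitnessFamily.Negative.MinkowskiSettled
import Literature.Geometry.Lorentzian.LeafAdaptedModelChartsMinkowski
import HarnessLib

/-!
# Crux `ClusterCompleteness.OmegaLimitMultiKerr` (stmt-FinalStateConjecture-14664), line `Sketch` —
# the `N = 0` certificate: the Minkowski development recurs at EVERY order, and settles

Support lemmas of the line lead (gen 1), over the landed vocabulary `Settles` / `Recurs k` of
`ClusterCompletenessOmegaLimitMultiKerrDefs`.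

* `recurs_minkowski_vacuumCauchyDevelopment` — the recur interface `Recurs k 𝒟` of the crux
  (anchored, separating, exhaustive final-state-shaped late charts with `Cᵏ` `ε`-recurrence for every
  `ε > 0` and every near-zone radius; verbatim the hypothesis of the route target
  `RecurrentMultiKerrCapture` and of `RecurrentlyFlatDisperses`) is HONESTLY SATISFIABLE AT EVERY ORDER
  `k`: the vacuum Cauchy development `Minkowski.vacuumCauchyDevelopment` of the trivial datum
  `(ℝ³, δ, 0)` recurs at order `k` with `N = 0` holes, flat domain all of `ℝ⁴`, the identity flat chart
  and `τ₀ = 0`. All ingredients are tree lemmas: the identity chart is a late chart with identically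
  vanishing `Cᵏ` deviation (`Minkowski.isLateChart_vacuumCauchyDevelopment_subtypeVal`,
  `Minkowski.deviationCk_vacuumCauchyDevelopment_subtypeVal`), `J⁺({x⁰ = 0}) = {x⁰ ≥ 0}`
  (`UniversalWitnessFamily.Negative.causalFuture_range_sliceEmbed`), vertical timelike segments
  (`SeamedChartsExhaust.Negative.ReversedModel.mem_chronologicalFuture_add_smul`) for `I⁻`, and the solid
  past cones (`Minkowski.mem_causalPast_vacuumCauchyDevelopment`) for exhaustion.
* `settles_minkowski_vacuumCauchyDevelopment` — the settle disjunct `Settles` holds for the same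
  development (this is `UniversalWitnessFamily.Negative.settledIn_minkowski`, read in the crux's
  vocabulary), so BOTH disjuncts of `OmegaLimitMultiKerr` are met by the dispersive model with identity
  charts, as the route's cheap-vetting clause (iv) demands; and `recurs_of_settles`
  (`…OmegaLimitMultiKerrSettlesRecurs.lean`) is not vacuous.

Consequence recorded for the crux chain: the route target `X = RecurrentMultiKerrCapture` is not vacuous
at any order (its hypothesis has a model for every `k`), so no `∃ k` shortcut through an unsatisfiable
interface exists. Everything is proved; nothing is re-derived that the tree already has.
-/

-- every `Summit.FinalStateConjecture.FinalStateConjecture.…` name repeats the summit = sub-problem segment (D-0017 layout)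
set_option linter.dupNamespace false

noncomputable section

open scoped Manifold ContDiff Topology ENNReal
open Set Filter TopologicalSpace

namespace Summit.FinalStateConjecture.FinalStateConjecture.Theorems.ClusterCompleteness

open Literature.Geometry.Lorentzian
open Summit.FinalStateConjecture.FinalStateConjecture.Theorems.UniversalWitnessFamily.Negative
  (minkowskiExterior causalFuture_range_sliceEmbed settledIn_minkowski)
open Summit.FinalStateConjecture.FinalStateConjecture.Theorems.SeamedChartsExhaust.Negative.ReversedModel
  (mem_chronologicalFuture_add_smul)

/-- **The `N = 0` certificate** (registered stub `recurs_minkowski_vacuumCauchyDevelopment` of the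
crux's line `Sketch`). The vacuum Cauchy development of the trivial datum `(ℝ³, δ, 0)` by
Minkowski spacetime satisfies the recur interface `Recurs k` of the crux `OmegaLimitMultiKerr` at
EVERY order `k`: no holes, flat domain `U₀ = ℝ⁴`, identity flat chart, `τ₀ = 0`,
`O = J⁺({t = 0}) ∩ I⁻({t > 0}) (= {t ≥ 0})`; every deviation is `0`, the covering of `O` and its
exhaustion are vertical segments of `ℝ⁴`, separation and sublinearity are vacuous. In particular the
recur interface — verbatim the hypothesis of `RecurrentMultiKerrCapture` — has a model at every
order. Christodoulou–Klainerman 1993, Thm. 1.0.2 (Minkowski space is its own final state).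
[folklore] -/
theorem recurs_minkowski_vacuumCauchyDevelopment :
    ∀ k : ℕ, Recurs k Minkowski.vacuumCauchyDevelopment := by
  intro k
  have hL := Minkowski.isLateChart_vacuumCauchyDevelopment_subtypeVal 0
  refine ⟨Summit.FinalStateConjecture.exteriorOf Minkowski.vacuumCauchyDevelopment.toCauchyDevelopment
      ((Subtype.val : (⊤ : Opens E4) → E4) '' (Minkowski.backgroundOn ⊤).lateRegion 0),
    0, Fin.elim0, Fin.elim0, Fin.elim0, 0, fun i ↦ i.elim0, Fin.elim0, Fin.elim0, ⊤, Subtype.val,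
    fun i ↦ i.elim0, fun i ↦ i.elim0, ⟨hL.contMDiff, hL.isOpenEmbedding, ?_⟩, fun i ↦ i.elim0,
    fun i ↦ i.elim0, fun _ _ ↦ trivial, fun _ ↦ ⟨0, fun i ↦ i.elim0⟩, ?_, fun τ₁ _ ↦ ?_,
    fun τ _ ↦ ⟨?_, fun i ↦ i.elim0⟩, fun R' ε _ ↦ ?_⟩
  · -- the late half-space `{t > 0}` lies in `O = J⁺({t = 0}) ∩ I⁻({t > 0})`
    rintro p ⟨x, hx, rfl⟩
    refine ⟨?_, ?_⟩
    · change (x : E4) ∈ (Minkowski.spacetime.metric.causalFuture Minkowski.spacetime.timeOrientation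
        (range Minkowski.sliceEmbed) : Set E4)
      rw [causalFuture_range_sliceEmbed]
      exact le_of_lt (show (0 : ℝ) < (x : E4) 0 from hx)
    · -- `x ≪ x + e₀ ∈ {t > 0}` (vertical timelike segment)
      have hq : (x : E4) + (1 : ℝ) • E4.basisVector 0 ∈
          (Subtype.val : (⊤ : Opens E4) → E4) '' (Minkowski.backgroundOn ⊤).lateRegion 0 := by
        refine ⟨⟨(x : E4) + (1 : ℝ) • E4.basisVector 0, trivial⟩, ?_, rfl⟩
        change (0 : ℝ) < ((x : E4) + (1 : ℝ) • E4.basisVector 0) 0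
        have hx0 : (0 : ℝ) < (x : E4) 0 := hx
        simpa using add_pos hx0 one_pos
      exact LorentzianMetric.chronologicalFuture_mono
        (τ := TimeOrientation.reverse Minkowski.spacetime.timeOrientation)
        (singleton_subset_iff.mpr hq)
        (LorentzianMetric.mem_chronologicalPast_of_mem_chronologicalFuture
          (mem_chronologicalFuture_add_smul one_pos))
  · -- `O` is the exterior region of the charted late region (no holes)
    rw [iUnion_of_empty, empty_union]
  · -- exhaustion at every `τ₁ > 0`: points of `O` at time `≤ τ₁` lie below the slab `{t = τ₁}`
    rintro p ⟨-, hp⟩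
    change E4 at p
    have hp' : p 0 ≤ τ₁ := not_lt.mp fun h ↦ hp (Or.inl ⟨⟨p, trivial⟩, h, rfl⟩)
    refine LorentzianMetric.causalFuture_mono
      (τ := TimeOrientation.reverse Minkowski.vacuumCauchyDevelopment.timeOrientation)
      (singleton_subset_iff.mpr (Or.inl ⟨⟨E4.ofTimeSpace τ₁ (E4.spatial p), trivial⟩,
        (E4.ofTimeSpace_apply_zero τ₁ (E4.spatial p) : E4.ofTimeSpace τ₁ (E4.spatial p) 0 = τ₁),
        rfl⟩)) (Minkowski.mem_causalPast_vacuumCauchyDevelopment ?_)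
    simp only [E4.spatial_ofTimeSpace, sub_self, norm_zero, E4.ofTimeSpace_apply_zero, sub_nonneg]
    exact hp'
  · -- the uniform `C⁰` anchor: the deviation is `0`
    exact (Minkowski.deviationCk_vacuumCauchyDevelopment_subtypeVal 0 τ).trans_le zero_le
  · -- recurrence at order `k`: the deviation is `0` at every time
    exact Frequently.of_forall fun τ ↦
      ⟨(Minkowski.deviationCk_vacuumCauchyDevelopment_subtypeVal k τ).trans_le zero_le,
        fun i ↦ i.elim0⟩

/-- **The same development settles down** in the sense of the Statement (complete `𝓘⁺` in the
sojourn form and the honest exhaustive `N = 0` decomposition of `{t ≥ 0}`): the tree theorem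
`UniversalWitnessFamily.Negative.settledIn_minkowski`, read in the crux's vocabulary `Settles`.
Christodoulou–Klainerman 1993, Thm. 1.0.2. [folklore] -/
theorem settles_minkowski_vacuumCauchyDevelopment : Settles Minkowski.vacuumCauchyDevelopment :=
  settledIn_minkowski

/-- **Both disjuncts of the crux have a common model**: some vacuum Cauchy development of the
(admissible, `trivialData_mem_admissibleVacuumData`) trivial datum settles AND recurs at every order.
[folklore] -/
theorem exists_settles_and_forall_recurs :
    ∃ 𝒟 : VacuumCauchyDevelopment trivialData, Settles 𝒟 ∧ ∀ k, Recurs k 𝒟 :=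
  ⟨Minkowski.vacuumCauchyDevelopment, settles_minkowski_vacuumCauchyDevelopment,
    recurs_minkowski_vacuumCauchyDevelopment⟩

end Summit.FinalStateConjecture.FinalStateConjecture.Theorems.ClusterCompleteness

end
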